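import Summits.QuantumAdvantage.QuantumAdvantage.Theses.LinnikCubicClassGroups
import Mathlib.Analysis.SpecialFunctions.Log.Basic
import Mathlib.Analysis.Complex.ExponentialBounds
import Mathlib.Data.Nat.Size

/-!
# Crux `LinnikCubicClassGroups.PureCubicClassGroupFBQP` (stmt-QuantumAdvantage-11544) — stub `stub_classTableSem`, part NUMERICS

Line `arakelov-giant-step-cycle`, stub `stub_classTableSem` (S5b-P5b): the pure real-variable inequalities behind the walk
parameters of the ladder class table (`KN = 10 size(ab) + 48`, `KInt = 2^prec KN`, `LB = log(3√|d_K|) ≤ (KN − 1)/11`,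
`prec ≥ 9`):

* `num_hbase_lower` — the ladder base sits at `p₀ ≥ 2 KInt` (`s₀ = 18 KN` steps, six-gap: `⌊s₀/6⌋ log 2 = 3 KN log 2 > 2 KN`);
* `num_baby_budget` — `Bb ≥ 32 KN²` guarded baby steps out-advance the residual `< p₀ + KInt ≤ 2^prec (18 KN·LB + KN) + 18 KN`;
* `num_nmax` — the number of fired baby steps is `≤ 20 KN²`;
* `num_levels` — ladder levels `i > 6 LD + 9` never fire (`p_i ≥ (2^i + 1) KInt > 2 Rint ≤ 2^prec (2 d⁶ + 2)`, `d < 2^LD`).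
-/

set_option linter.dupNamespace false

namespace Summit.QuantumAdvantage.QuantumAdvantage.Theorems.LinnikCubicClassGroups

/-- `2^9 ≤ 2^prec` for `prec ≥ 9`, read in `ℝ`. -/
theorem num_two_pow_ge {prec : ℕ} (hprec : 9 ≤ prec) : (512 : ℝ) ≤ 2 ^ prec := by
  calc (512 : ℝ) = 2 ^ 9 := by norm_num
    _ ≤ 2 ^ prec := pow_le_pow_right₀ (by norm_num) hprec

/-- **The ladder base is far enough**: `2 KInt ≤ p₀`. -/
theorem num_hbase_lower {prec KN : ℕ} {p₀ G : ℝ} (hprec : 9 ≤ prec) (hKN : 1 ≤ KN)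
    (herr : |p₀ - 2 ^ prec * G| ≤ ((18 * KN : ℕ) : ℝ)) (hG : ((18 * KN / 6 : ℕ) : ℝ) * Real.log 2 ≤ G) :
    2 * ((2 ^ prec * KN : ℕ) : ℝ) ≤ p₀ := by
  have h2p := num_two_pow_ge hprec
  have hdiv : (18 * KN / 6 : ℕ) = 3 * KN := by omega
  rw [hdiv] at hG
  have hl2 := Real.log_two_gt_d9
  rw [abs_le] at herr
  push_cast at herr hG ⊢
  have hKN' : (1 : ℝ) ≤ KN := by exact_mod_cast hKN
  have h1 : (2 : ℝ) ^ prec * (3 * KN * 0.6931471803) ≤ 2 ^ prec * G := by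
    apply mul_le_mul_of_nonneg_left _ (by positivity); nlinarith
  nlinarith [mul_le_mul_of_nonneg_right h2p (by positivity : (0 : ℝ) ≤ KN)]

/-- `6 ⌊n/6⌋ ≥ n − 5`, read in `ℝ`. -/
theorem num_div_six (n : ℕ) : (n : ℝ) - 5 ≤ 6 * ((n / 6 : ℕ) : ℝ) := by
  have h := Nat.div_add_mod n 6
  have h2 : n % 6 < 6 := Nat.mod_lt _ (by norm_num)
  have : (n : ℝ) = 6 * ((n / 6 : ℕ) : ℝ) + ((n % 6 : ℕ) : ℝ) := by exact_mod_cast h.symm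
  have h3 : ((n % 6 : ℕ) : ℝ) ≤ 5 := by exact_mod_cast Nat.lt_succ_iff.mp h2
  linarith

/-- **The baby-step budget**: the residual after the descent is out-advanced by `Bb ≥ 32 KN²` six-gapped steps. -/
theorem num_baby_budget {prec KN Bb : ℕ} {LB C : ℝ} (hprec : 9 ≤ prec) (hKN48 : 48 ≤ KN) (hLB : 11 * LB + 1 ≤ KN)
    (hLB0 : 0 ≤ LB) (hBb : 32 * KN ^ 2 ≤ Bb) (hC : C ≤ 2 ^ prec * (18 * KN * LB + KN) + 18 * KN) :
    C < 2 ^ prec * ((Bb / 6 : ℕ) : ℝ) * Real.log 2 - Bb := by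
  have h2p := num_two_pow_ge hprec
  have hl2 := Real.log_two_gt_d9
  have hl2' := Real.log_two_lt_d9
  have hKN' : (48 : ℝ) ≤ KN := by exact_mod_cast hKN48
  have hBb' : (32 : ℝ) * (KN : ℝ) ^ 2 ≤ Bb := by exact_mod_cast hBb
  have hd6 := num_div_six Bb
  -- lower bound for the right-hand side
  have hR : ((Bb : ℝ) - 5) / 6 * (2 ^ prec * Real.log 2) - Bb ≤ 2 ^ prec * ((Bb / 6 : ℕ) : ℝ) * Real.log 2 - Bb := by
    have : ((Bb : ℝ) - 5) / 6 ≤ ((Bb / 6 : ℕ) : ℝ) := by linarith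
    nlinarith [mul_le_mul_of_nonneg_right this (by positivity : (0 : ℝ) ≤ 2 ^ prec * Real.log 2)]
  -- the coefficient of `Bb` is positive
  have hcoef : (58 : ℝ) ≤ 2 ^ prec * Real.log 2 / 6 - 1 := by
    rw [le_sub_iff_add_le, le_div_iff₀ (by norm_num)]; nlinarith
  have hLB' : LB ≤ (KN - 1) / 11 := by rw [le_div_iff₀ (by norm_num)]; linarith
  have hL : C ≤ 2 ^ prec * (18 * KN * ((KN - 1) / 11) + KN) + 18 * KN := by
    refine hC.trans ?_
    have : 18 * (KN : ℝ) * LB ≤ 18 * KN * ((KN - 1) / 11) := by nlinarith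
    nlinarith
  have key : 2 ^ prec * (18 * (KN : ℝ) * ((KN - 1) / 11) + KN) + 18 * KN <
      ((Bb : ℝ) - 5) / 6 * (2 ^ prec * Real.log 2) - Bb := by
    -- `Bb (c) - (5/6) 2^prec log 2` with `Bb ≥ 32 KN²`, `c ≥ 58`
    have e : ((Bb : ℝ) - 5) / 6 * (2 ^ prec * Real.log 2) - Bb =
        Bb * (2 ^ prec * Real.log 2 / 6 - 1) - 5 / 6 * (2 ^ prec * Real.log 2) := by ring
    rw [e]
    have h1 : (32 : ℝ) * KN ^ 2 * (2 ^ prec * Real.log 2 / 6 - 1) ≤ Bb * (2 ^ prec * Real.log 2 / 6 - 1) :=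
      mul_le_mul_of_nonneg_right hBb' (by linarith)
    have h2 : (2 : ℝ) ^ prec * (18 * KN * ((KN - 1) / 11) + KN) ≤ 2 ^ prec * (1.7 * KN ^ 2) := by
      apply mul_le_mul_of_nonneg_left _ (by positivity); nlinarith
    have h3 : (32 : ℝ) * KN ^ 2 * (2 ^ prec * Real.log 2 / 6 - 1) ≥ 32 * KN ^ 2 * (2 ^ prec * 0.115) - 32 * KN ^ 2 := by
      nlinarith [mul_le_mul_of_nonneg_left hl2.le (by positivity : (0 : ℝ) ≤ 2 ^ prec * KN ^ 2)]
    nlinarith [mul_le_mul_of_nonneg_right h2p (by positivity : (0 : ℝ) ≤ KN ^ 2),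
      mul_le_mul_of_nonneg_right h2p (by positivity : (0 : ℝ) ≤ KN)]
  linarith

/-- **The number of fired baby steps is at most `20 KN²`.** -/
theorem num_nmax {prec KN n : ℕ} {LB C : ℝ} (hprec : 9 ≤ prec) (hKN48 : 48 ≤ KN) (hLB : 11 * LB + 1 ≤ KN)
    (hLB0 : 0 ≤ LB) (hC : C ≤ 2 ^ prec * (18 * KN * LB + KN) + 18 * KN)
    (hn : 2 ^ prec * ((n / 6 : ℕ) : ℝ) * Real.log 2 - n ≤ C) : (n : ℝ) ≤ 20 * (KN : ℝ) ^ 2 := by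
  have h2p := num_two_pow_ge hprec
  have hl2 := Real.log_two_gt_d9
  have hl2' := Real.log_two_lt_d9
  have hKN' : (48 : ℝ) ≤ KN := by exact_mod_cast hKN48
  have hd6 := num_div_six n
  have hLB' : LB ≤ (KN - 1) / 11 := by rw [le_div_iff₀ (by norm_num)]; linarith
  have hL : C ≤ 2 ^ prec * (1.7 * (KN : ℝ) ^ 2) + 18 * KN := by
    refine hC.trans ?_
    have : 18 * (KN : ℝ) * LB ≤ 18 * KN * ((KN - 1) / 11) := by nlinarith
    have h2 : (2 : ℝ) ^ prec * (18 * KN * ((KN - 1) / 11) + KN) ≤ 2 ^ prec * (1.7 * KN ^ 2) := by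
      apply mul_le_mul_of_nonneg_left _ (by positivity); nlinarith
    nlinarith
  have hn' : ((n : ℝ) - 5) / 6 * (2 ^ prec * Real.log 2) - n ≤ C := by
    have : ((n : ℝ) - 5) / 6 ≤ ((n / 6 : ℕ) : ℝ) := by linarith
    nlinarith [mul_le_mul_of_nonneg_right this (by positivity : (0 : ℝ) ≤ 2 ^ prec * Real.log 2)]
  by_contra hcon
  push Not at hcon
  have hcoef : (0.115 : ℝ) * 2 ^ prec - 1 ≤ 2 ^ prec * Real.log 2 / 6 - 1 := by
    rw [sub_le_sub_iff_right, le_div_iff₀ (by norm_num)]; nlinarith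
  have e : ((n : ℝ) - 5) / 6 * (2 ^ prec * Real.log 2) - n = n * (2 ^ prec * Real.log 2 / 6 - 1) - 5 / 6 * (2 ^ prec * Real.log 2) := by
    ring
  rw [e] at hn'
  have h1 : (20 : ℝ) * KN ^ 2 * (0.115 * 2 ^ prec - 1) ≤ n * (2 ^ prec * Real.log 2 / 6 - 1) := by
    calc (20 : ℝ) * KN ^ 2 * (0.115 * 2 ^ prec - 1) ≤ 20 * KN ^ 2 * (2 ^ prec * Real.log 2 / 6 - 1) :=
          mul_le_mul_of_nonneg_left hcoef (by positivity)
      _ ≤ n * (2 ^ prec * Real.log 2 / 6 - 1) := mul_le_mul_of_nonneg_right hcon.le (by linarith)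
  nlinarith [mul_le_mul_of_nonneg_right h2p (by positivity : (0 : ℝ) ≤ KN ^ 2),
    mul_le_mul_of_nonneg_right h2p (by positivity : (0 : ℝ) ≤ KN)]

/-- **High ladder levels never fire**: `2 Rint < p_i + KInt` for `i > 6 LD + 9`. -/
theorem num_levels {prec LD i : ℕ} {KInt Rint p d : ℝ} (hpi : (2 ^ i + 1) * KInt ≤ p) (hKInt : 2 ^ prec ≤ KInt)
    (hi : 6 * LD + 9 < i) (hR : 2 * Rint ≤ 2 ^ prec * (2 * d ^ 6 + 2)) (hd0 : 0 ≤ d) (hd : d < 2 ^ LD) :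
    2 * Rint < p + KInt := by
  have hK0 : 0 < KInt := lt_of_lt_of_le (by positivity) hKInt
  have hd6 : d ^ 6 < (2 : ℝ) ^ (6 * LD) := by
    calc d ^ 6 < ((2 : ℝ) ^ LD) ^ 6 := pow_lt_pow_left₀ hd hd0 (by norm_num)
      _ = 2 ^ (6 * LD) := by rw [← pow_mul, mul_comm]
  have h2i : (2 : ℝ) ^ (6 * LD + 10) ≤ 2 ^ i := pow_le_pow_right₀ (by norm_num) hi
  have e : (2 : ℝ) ^ (6 * LD + 10) = 2 ^ (6 * LD) * 1024 := by rw [pow_add]; norm_num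
  have h1 : 2 * (d ^ 6) + 2 < (2 : ℝ) ^ (6 * LD + 10) := by
    rw [e]
    have : (1 : ℝ) ≤ 2 ^ (6 * LD) := one_le_pow₀ (by norm_num)
    nlinarith
  calc 2 * Rint ≤ 2 ^ prec * (2 * d ^ 6 + 2) := hR
    _ < 2 ^ prec * 2 ^ i := mul_lt_mul_of_pos_left (h1.trans_le h2i) (by positivity)
    _ ≤ KInt * 2 ^ i := mul_le_mul_of_nonneg_right hKInt (by positivity)
    _ ≤ p := by nlinarith
    _ < p + KInt := by linarith


/-- **P5b helper `classTableSem_num_baby_budget`** (registered): the baby-step budget inequality. -/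
theorem classTableSem_num_baby_budget : ∀ (prec KN Bb : ℕ) (LB C : ℝ), 9 ≤ prec → 48 ≤ KN → 11 * LB + 1 ≤ KN → 0 ≤ LB → 32 * KN ^ 2 ≤ Bb → C ≤ 2 ^ prec * (18 * KN * LB + KN) + 18 * KN → C < 2 ^ prec * ((Bb / 6 : ℕ) : ℝ) * Real.log 2 - Bb :=
  fun _ _ _ _ _ hprec hKN hLB hLB0 hBb hC => num_baby_budget hprec hKN hLB hLB0 hBb hC

end Summit.QuantumAdvantage.QuantumAdvantage.Theorems.LinnikCubicClassGroups
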